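import Summits.QuantumFields.BalabanUV.Beta.GAN24.ContactBorderCellLetters
import Summits.QuantumFields.BalabanUV.Beta.GAN24.ContactLambdaEntryBound
import Summits.QuantumFields.BalabanUV.Beta.GAN24.ContactBorderCommutator

/-!
# `BalabanUV.Beta.GAN24.ContactBorderEntryBound` — binder row G-an2-4 / (CONV-C), CT-ROUTE, the row owner's `gen21/BORNV-PLAN-v0.md` §4 «(V-C)», (C4)-V module (B2):
# **THE V CELL SUMS AND THE ENTRY BOUND OF THE V CONTACT DIFFERENCE FROM LETTERS** (generic `d`) — the V twin of leaf-02 g49's (C4) PART 3 `ContactLambdaEntryBound`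

NOT IN PRINT; OUR BOOKKEEPING (G-an2-4 formalisation swarm → CRUX TEAM (2), leaf prover `b2b-balaban-gan24-formalise-leaf-03`, gen 55; (C4)-V: leaf-02 g49 «NOT MINE — GO, YOURS» l.34851,
the OWNER gan24-p1-g21 W17 «(V-C) typist of record: leaf-03» l.34977).  [folklore] bookkeeping over leaf-02 g48's factorised V sockets `ContactBorderCommutator.contact_border_fm∕mf_eq_factorised`,
leaf-02 g49's channel-blind count `ContactLambdaCellBound.abs_sum_tsum_mul_le_of_env3` (whose per-direction step is MY `StaircaseFaceDensity.tsum_abs_mul_le_of_faceLetter'`) and localised gauge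
letters `ContactGaugeStaircaseLocal.abs_finest_le_env ∕ abs_dz_finest_le_env ∕ sum_abs_jump_le_env ∕ env_label_le ∕ corner_*`, leaf-01 g60's `ContactFaceJumpBorder.tipCommutator_eq_sum` ∕
`ContactLambdaEntryBound.sum_abs_linCountAt_le_cnt ∕ mul_sum_ite`, (B1) `ContactBorderCellLetters` (the TIP∕ROOT∕TIP×GRADIENT letters in envelope form), `ResolventComposition.tsum_sublattice₀` BY NAME.
Generic `d`; every analytic input a LETTER; 0 `def`, 0 cited facts, 0 `def … : Prop`, 0 sorry; NO estimate of Bałaban's.  HONEST FRAMING (cell contract, verbatim): «discharging `BetaPertH`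
makes Bałaban's UV stability UNCONDITIONAL — a real constructive-QFT result; it is NOT the continuum limit and NOT the Clay problem.»  HONEST DEPENDENCY (verbatim): «continuum YM on T⁴ ⇐
BetaPertH ∧ nine spine estimates (0/9 proved); BetaPertH ⇐ (D1) ∧ (D4) ∧ CAP+tail; G-an2-4 gates asym, D1 and NE2/3/4.»

## What (generic `d`, `1 ≤ Lc`, box root `ρ = toSite rr`; relative blocking `Lc^{n+1}` (legs, gauge pieces) ∕ `Lc^n` (the multiplier-leg tent); ONE rate `κ > 0`;
## `E₀ := e^{2(d+1)κ}`, `Cnt := (2Lc)^{d+1}·((d+1)·(Lc^{d+1}·ell (d+1) Lc))`)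
* (the count constant `sum_abs_linCountAt_le_cnt` and `mul_sum_ite` are leaf-02's PART 3, BY NAME)
* §1 THE THREE V CELL SUMS against three block-scale envelopes (tent label `u′`, gauge source `x_g`, leg ∕ second gauge source `x_l`):
  **`abs_sum_tsum_tip_le`** (TIP cell, undressed leg: `≤ (d+1)·T_b·(E₀²·K_B·Cnt)·(2α_g + 2α_g·Lc·n)·((Lc^n)^{d+1}·Zl)·e^{−(κ∕12)(‖x_g−u′‖∞+‖x_l−u′‖∞)}`),
  **`abs_sum_tsum_root_le`** (ROOT cell, same constant), **`abs_sum_tsum_tip_dz_le`** (TIP × GRADIENT cell: `… ·(E₀²·Cnt)·(4α_g² + 2·(4α_g²)·Lc·n)·…`).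
* §2 **`abs_contact_border_fm_le`** — THE ENTRY BOUND OF THE fm-CHANNEL V CONTACT DIFFERENCE: legs `T` (dressed: bounded, summable fine slices) and `B` (undressed: block envelope
  `K_B·e^{−κ‖quo (Lc^{n+1}) u − z‖∞}`) with `T − B = dz λ`, the bond gauge functions `λ_{μ₀z₀}` staircases of depth `n+1` with localised geometric pieces (`α_g·Lc^s`, source `z₀`), a COMMON
  multiplier leg `M` (summable fine slices) under the TENT letter `|M β z′ μ (Lc•y)| ≤ T_b·e^{−κ‖quo (Lc^n) y − z′‖∞}`; then for all `κ′ u′ x′ z′ α β`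
  `|push₃ T M T (reslot inl inr V_ρ) κ′u′ x′z′ (inl α)(inl β) − push₃ B M B (reslot inl inr V_ρ) κ′u′ x′z′ (inl α)(inl β)|`
  `≤ (Lc^{d+1})⁻¹·((d+1)·T_b·(E₀²·Cnt))·(2·K_B·(2α_g + 2α_g·Lc·n) + (4α_g² + 8α_g²·Lc·n))·((Lc^n)^{d+1}·Zl(κ∕(4(d+1))))·e^{−(κ∕12)(‖x′−z′‖∞ + ‖u′−z′‖∞)}`
  (`V_ρ = vhSAt ρ d Lc` the bare rooted border table) — socket → sublattice re-indexing `z = Lc•y` → split of the TIP cell's dressed leg `T = B + dz λ` → §1 thrice.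
NOT HERE: the mf channel ((B3) `ContactBorderEntryBoundMf`), the `d = 3` letters and the unit count → `hCv` ((C)∕(D)); the multiplier leg is COMMON by (A) `MultiplierLegWard`.  Discharges NO
letter of (CONV-C); hCv ∕ hV ∕ hB ∕ hS0-comb OPEN; NEVER «G-an2-4 closed» as (CONV-C); NOT D1, NOT BetaPertH, NOT continuum, NOT Clay.  Unit `b2b-balaban-gan24-formalise-leaf-03` (gen 55), 2026-08-21.
-/

noncomputable section

open Finset
open scoped BigOperators
open Literature.MathematicalPhysics.QuantumFieldTheory
open Literature.MathematicalPhysics.QuantumFieldTheory.LatticeForm (quo)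
open Literature.MathematicalPhysics.QuantumFieldTheory.Balaban1983to89
open Literature.MathematicalPhysics.QuantumFieldTheory.Balaban1983to89.Beta
open Literature.Probability.LatticeModels (Torus.proj)
open B4ContourShift (supNorm supNorm_nonneg)
open B12Sec2to5 (l1 l1_nonneg)
open ExpKernelCalculus (MKer Zl Zl_nonneg)
open AffineAveraging (Form0 Form1 Site box toSite unitVec dz)
open AveragingContours (blk off)
open AveragingContoursRooted (linAvgAt)
open AveragingHessianKernels (ell eq_smul_blk_of_off_eq_zero)
open AveragingHessianKernelsRooted (linCountAt vhSAt)
open AxialProjector (blk_zsmul)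
open RootedKernelReflection (off_zsmul)
open ResolventComposition (tsum_sublattice₀)
open OneStepResolventKernel (Fib proj_zsmul)
open Summit.QuantumFields.BalabanUV.Beta.LinearGaugeVH (nearBox mem_nearBox)
open Summit.QuantumFields.BalabanUV.Beta.GAN24.SrecLinearPartEq (reslot)
open Summit.QuantumFields.BalabanUV.Beta.GAN24.Push3 (push₃)
open Summit.QuantumFields.BalabanUV.Beta.GAN24.Push3LegTelescope (abs_le_of_env' summable_of_env')
open Summit.QuantumFields.BalabanUV.Beta.GAN24.ContactLambdaEntryBound (sum_abs_linCountAt_le_cnt mul_sum_ite)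
open Summit.QuantumFields.BalabanUV.Beta.GAN24.ContactFaceJumpBorder (tipCommutator_eq_sum)
open Summit.QuantumFields.BalabanUV.Beta.GAN24.ContactLambdaCellBound (abs_sum_tsum_mul_le_of_env3)
open Summit.QuantumFields.BalabanUV.Beta.GAN24.ContactGaugeStaircaseLocal (env_label_le corner_le_of_mem_nearBox corner_le_of_mem_nearBox_add corner_le_root
  corner_le_root_add abs_finest_le_env abs_dz_finest_le_env sum_abs_jump_le_env)
open Summit.QuantumFields.BalabanUV.Beta.GAN24.ContactBorderCellLetters (abs_tipCommutator_le_of_staircase_of_env abs_rootCommutator_le_of_staircase_of_env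
  abs_tipCommutator_dz_le_of_staircase_of_env)
open Summit.QuantumFields.BalabanUV.Beta.GAN24.ContactBorderCommutator (contact_border_fm_eq_factorised)

namespace Summit.QuantumFields.BalabanUV.Beta.GAN24.ContactBorderEntryBound

variable {d : ℕ} {Lc : ℕ} {rr : Fin (d + 1) → ℕ}

/-! ## §1 The three V cell sums -/

section Tip

variable {n : ℕ} {κ αg KB Tb : ℝ} {Gs : ℕ → Site (d + 1) → ℝ} {ψ : Site (d + 1) → ℝ} {R : Form1 (d + 1) ℝ}
  {b : Fin (d + 1) → Site (d + 1) → ℝ} {xg xl u' : Site (d + 1)}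

/-- NOT IN PRINT; OUR BOOKKEEPING ([folklore]; every input a letter).  **THE TIP CELL** (undressed leg): brackets under the tent letter at blocking `Lc^n` and label `u′`, a gauge staircase
`ψ = Σ_{s<n+1} G s ∘ blk (Lc^s)` with localised geometric pieces (source label `x_g`), a leg under a block envelope (label `x_l`):
`|Σ_μ Σ'_y b μ y·(linAvgAt ρ (ψ⁺•R) Lc μ y − ψ(Lc·y+ρ+Lc·e_μ)·linAvgAt ρ R Lc μ y)| ≤ (d+1)·T_b·(E₀²·K_B·Cnt)·(2α_g + 2·α_g·Lc·n)·((Lc^n)^{d+1}·Zl)·e^{−(κ∕12)(‖x_g − u′‖∞ + ‖x_l − u′‖∞)}`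
and every `y`-family is summable (finest tip weight: TWO sites, `2α_g`). -/
theorem abs_sum_tsum_tip_le (hLc : 1 ≤ Lc) (hrr : rr ∈ box (d + 1) Lc) (hκ : 0 < κ) (hαg : 0 ≤ αg) (hKB : 0 ≤ KB) (hTb : 0 ≤ Tb)
    (hψ : ∀ u, ψ u = ∑ s ∈ Finset.range (n + 1), Gs s (blk (Lc ^ s) u))
    (hG : ∀ s, s ≤ n → ∀ u, |Gs s (blk (Lc ^ s) u)| ≤ αg * (Lc : ℝ) ^ s * Real.exp (-(κ * supNorm (quo (Lc ^ (n + 1)) u - xg))))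
    (hR : ∀ a x, |R a x| ≤ KB * Real.exp (-(κ * supNorm (quo (Lc ^ (n + 1)) x - xl))))
    (hb : ∀ μ y, |b μ y| ≤ Tb * Real.exp (-(κ * supNorm (quo (Lc ^ n) y - u')))) :
    (∀ μ, Summable fun y : Site (d + 1) => b μ y *
        (linAvgAt (toSite rr) (fun a x => ψ (x + unitVec a) * R a x) Lc μ y
          - ψ ((Lc : ℤ) • y + toSite rr + (Lc : ℤ) • unitVec μ) * linAvgAt (toSite rr) R Lc μ y)) ∧
    |∑ μ, ∑' y : Site (d + 1), b μ y *
        (linAvgAt (toSite rr) (fun a x => ψ (x + unitVec a) * R a x) Lc μ y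
          - ψ ((Lc : ℤ) • y + toSite rr + (Lc : ℤ) • unitVec μ) * linAvgAt (toSite rr) R Lc μ y)|
      ≤ ((d : ℝ) + 1) * Tb * (Real.exp (2 * ((d : ℝ) + 1) * κ) ^ 2 * KB *
            (((2 * Lc : ℕ) : ℝ) ^ (d + 1) * (((d + 1 : ℕ) : ℝ) * ((Lc : ℝ) ^ (d + 1) * (ell (d + 1) Lc : ℝ)))))
          * (2 * αg + 2 * αg * Lc * n) * ((((Lc ^ n : ℕ) : ℝ)) ^ (d + 1) * Zl (d + 1) (κ / (4 * ((d : ℝ) + 1)))) *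
          Real.exp (-(κ / 12) * (supNorm (xg - u') + supNorm (xl - u'))) := by
  set E₀ : ℝ := Real.exp (2 * ((d : ℝ) + 1) * κ) with hE₀
  set Cnt : ℝ := ((2 * Lc : ℕ) : ℝ) ^ (d + 1) * (((d + 1 : ℕ) : ℝ) * ((Lc : ℝ) ^ (d + 1) * (ell (d + 1) Lc : ℝ))) with hCnt
  have hE₀0 : 0 ≤ E₀ := (Real.exp_pos _).le
  have hLn : 1 ≤ Lc ^ n := Nat.one_le_pow _ _ hLc
  have hc : ∀ μ y, |linAvgAt (toSite rr) (fun a x => ψ (x + unitVec a) * R a x) Lc μ y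
        - ψ ((Lc : ℤ) • y + toSite rr + (Lc : ℤ) • unitVec μ) * linAvgAt (toSite rr) R Lc μ y|
      ≤ (2 * αg + ∑ s ∈ Finset.range n, (if (Lc : ℤ) ^ s ∣ y μ + 1 then 2 * ((fun m => αg * (Lc : ℝ) ^ m) (s + 1)) else 0)) *
        ((E₀ ^ 2 * KB * Cnt) * Real.exp (-(κ * supNorm (quo (Lc ^ n) y - xg))) * Real.exp (-(κ * supNorm (quo (Lc ^ n) y - xl)))) := by
    intro μ y
    have hW : ∀ a, ∀ x ∈ nearBox Lc y, |Gs 0 (x + unitVec a) - Gs 0 ((Lc : ℤ) • y + toSite rr + (Lc : ℤ) • unitVec μ)|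
        ≤ 2 * αg * (E₀ * Real.exp (-(κ * supNorm (quo (Lc ^ n) y - xg)))) := by
      intro a x hx
      have h1 := abs_finest_le_env hLc hκ.le hαg hG (corner_le_of_mem_nearBox_add hLc hx a)
      have h2 := abs_finest_le_env hLc hκ.le hαg hG (corner_le_root_add hrr y μ)
      calc |Gs 0 (x + unitVec a) - Gs 0 ((Lc : ℤ) • y + toSite rr + (Lc : ℤ) • unitVec μ)|
          ≤ |Gs 0 (x + unitVec a)| + |Gs 0 ((Lc : ℤ) • y + toSite rr + (Lc : ℤ) • unitVec μ)| := abs_sub _ _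
        _ ≤ _ := by linarith
    have hJ := sum_abs_jump_le_env hLc hκ.le hαg hG μ y
    have hB : ∀ a, ∀ x ∈ nearBox Lc y, |R a x| ≤ KB * (E₀ * Real.exp (-(κ * supNorm (quo (Lc ^ n) y - xl)))) := fun a x hx =>
      (hR a x).trans (mul_le_mul_of_nonneg_left (env_label_le hLc hκ.le n xl (corner_le_of_mem_nearBox hx)) hKB)
    have h := abs_tipCommutator_le_of_staircase_of_env hLc hrr Gs n hψ R μ y (W₀ := 2 * αg)
      (F := ∑ s ∈ Finset.range n, (if (Lc : ℤ) ^ s ∣ y μ + 1 then 2 * (αg * (Lc : ℝ) ^ (s + 1)) else 0))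
      (E := E₀ * Real.exp (-(κ * supNorm (quo (Lc ^ n) y - xg)))) (M := KB * (E₀ * Real.exp (-(κ * supNorm (quo (Lc ^ n) y - xl)))))
      (by positivity) (by positivity) (by positivity) hW hJ hB (sum_abs_linCountAt_le_cnt hLc hrr μ y)
    refine h.trans (le_of_eq ?_)
    simp only []
    ring
  have ha : ∀ s, s < n → 0 ≤ (fun m => αg * (Lc : ℝ) ^ m) (s + 1) ∧ (fun m => αg * (Lc : ℝ) ^ m) (s + 1) ≤ αg * (Lc : ℝ) ^ (s + 1) :=
    fun s _ => ⟨by positivity, le_rfl⟩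
  exact abs_sum_tsum_mul_le_of_env3 (d := d) (Lc := Lc) (M := Lc ^ n) (n := n) hLc hLn (fun s hs => pow_dvd_pow Lc hs.le) hκ
    (a := fun m => αg * (Lc : ℝ) ^ m) ha (b := b)
    (c := fun μ y => linAvgAt (toSite rr) (fun a x => ψ (x + unitVec a) * R a x) Lc μ y
          - ψ ((Lc : ℤ) • y + toSite rr + (Lc : ℤ) • unitVec μ) * linAvgAt (toSite rr) R Lc μ y)
    hTb (by positivity : 0 ≤ E₀ ^ 2 * KB * Cnt) (by positivity : (0 : ℝ) ≤ 2 * αg) u' xg xl hb hc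

/-- NOT IN PRINT; OUR BOOKKEEPING ([folklore]; every input a letter).  **THE ROOT CELL** (undressed leg): same letters, the ROOT commutator
`ψ(Lc·y+ρ)·linAvgAt ρ R Lc μ y − linAvgAt ρ (ψ•R) Lc μ y`; same constant as the TIP cell. -/
theorem abs_sum_tsum_root_le (hLc : 1 ≤ Lc) (hrr : rr ∈ box (d + 1) Lc) (hκ : 0 < κ) (hαg : 0 ≤ αg) (hKB : 0 ≤ KB) (hTb : 0 ≤ Tb)
    (hψ : ∀ u, ψ u = ∑ s ∈ Finset.range (n + 1), Gs s (blk (Lc ^ s) u))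
    (hG : ∀ s, s ≤ n → ∀ u, |Gs s (blk (Lc ^ s) u)| ≤ αg * (Lc : ℝ) ^ s * Real.exp (-(κ * supNorm (quo (Lc ^ (n + 1)) u - xg))))
    (hR : ∀ a x, |R a x| ≤ KB * Real.exp (-(κ * supNorm (quo (Lc ^ (n + 1)) x - xl))))
    (hb : ∀ μ y, |b μ y| ≤ Tb * Real.exp (-(κ * supNorm (quo (Lc ^ n) y - u')))) :
    (∀ μ, Summable fun y : Site (d + 1) => b μ y *
        (ψ ((Lc : ℤ) • y + toSite rr) * linAvgAt (toSite rr) R Lc μ y - linAvgAt (toSite rr) (fun a x => ψ x * R a x) Lc μ y)) ∧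
    |∑ μ, ∑' y : Site (d + 1), b μ y *
        (ψ ((Lc : ℤ) • y + toSite rr) * linAvgAt (toSite rr) R Lc μ y - linAvgAt (toSite rr) (fun a x => ψ x * R a x) Lc μ y)|
      ≤ ((d : ℝ) + 1) * Tb * (Real.exp (2 * ((d : ℝ) + 1) * κ) ^ 2 * KB *
            (((2 * Lc : ℕ) : ℝ) ^ (d + 1) * (((d + 1 : ℕ) : ℝ) * ((Lc : ℝ) ^ (d + 1) * (ell (d + 1) Lc : ℝ)))))
          * (2 * αg + 2 * αg * Lc * n) * ((((Lc ^ n : ℕ) : ℝ)) ^ (d + 1) * Zl (d + 1) (κ / (4 * ((d : ℝ) + 1)))) *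
          Real.exp (-(κ / 12) * (supNorm (xg - u') + supNorm (xl - u'))) := by
  set E₀ : ℝ := Real.exp (2 * ((d : ℝ) + 1) * κ) with hE₀
  set Cnt : ℝ := ((2 * Lc : ℕ) : ℝ) ^ (d + 1) * (((d + 1 : ℕ) : ℝ) * ((Lc : ℝ) ^ (d + 1) * (ell (d + 1) Lc : ℝ))) with hCnt
  have hE₀0 : 0 ≤ E₀ := (Real.exp_pos _).le
  have hLn : 1 ≤ Lc ^ n := Nat.one_le_pow _ _ hLc
  have hc : ∀ μ y, |ψ ((Lc : ℤ) • y + toSite rr) * linAvgAt (toSite rr) R Lc μ y - linAvgAt (toSite rr) (fun a x => ψ x * R a x) Lc μ y|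
      ≤ (2 * αg + ∑ s ∈ Finset.range n, (if (Lc : ℤ) ^ s ∣ y μ + 1 then 2 * ((fun m => αg * (Lc : ℝ) ^ m) (s + 1)) else 0)) *
        ((E₀ ^ 2 * KB * Cnt) * Real.exp (-(κ * supNorm (quo (Lc ^ n) y - xg))) * Real.exp (-(κ * supNorm (quo (Lc ^ n) y - xl)))) := by
    intro μ y
    have hW : ∀ x ∈ nearBox Lc y, |Gs 0 ((Lc : ℤ) • y + toSite rr) - Gs 0 x| ≤ 2 * αg * (E₀ * Real.exp (-(κ * supNorm (quo (Lc ^ n) y - xg)))) := by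
      intro x hx
      have h1 := abs_finest_le_env hLc hκ.le hαg hG (corner_le_root hrr y)
      have h2 := abs_finest_le_env hLc hκ.le hαg hG (corner_le_of_mem_nearBox hx)
      calc |Gs 0 ((Lc : ℤ) • y + toSite rr) - Gs 0 x| ≤ |Gs 0 ((Lc : ℤ) • y + toSite rr)| + |Gs 0 x| := abs_sub _ _
        _ ≤ _ := by linarith
    have hJ := sum_abs_jump_le_env hLc hκ.le hαg hG μ y
    have hB : ∀ a, ∀ x ∈ nearBox Lc y, |R a x| ≤ KB * (E₀ * Real.exp (-(κ * supNorm (quo (Lc ^ n) y - xl)))) := fun a x hx =>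
      (hR a x).trans (mul_le_mul_of_nonneg_left (env_label_le hLc hκ.le n xl (corner_le_of_mem_nearBox hx)) hKB)
    have h := abs_rootCommutator_le_of_staircase_of_env hLc hrr Gs n hψ R μ y (W₀ := 2 * αg)
      (F := ∑ s ∈ Finset.range n, (if (Lc : ℤ) ^ s ∣ y μ + 1 then 2 * (αg * (Lc : ℝ) ^ (s + 1)) else 0))
      (E := E₀ * Real.exp (-(κ * supNorm (quo (Lc ^ n) y - xg)))) (M := KB * (E₀ * Real.exp (-(κ * supNorm (quo (Lc ^ n) y - xl)))))
      (by positivity) (by positivity) (by positivity) hW hJ hB (sum_abs_linCountAt_le_cnt hLc hrr μ y)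
    refine h.trans (le_of_eq ?_)
    simp only []
    ring
  have ha : ∀ s, s < n → 0 ≤ (fun m => αg * (Lc : ℝ) ^ m) (s + 1) ∧ (fun m => αg * (Lc : ℝ) ^ m) (s + 1) ≤ αg * (Lc : ℝ) ^ (s + 1) :=
    fun s _ => ⟨by positivity, le_rfl⟩
  exact abs_sum_tsum_mul_le_of_env3 (d := d) (Lc := Lc) (M := Lc ^ n) (n := n) hLc hLn (fun s hs => pow_dvd_pow Lc hs.le) hκ
    (a := fun m => αg * (Lc : ℝ) ^ m) ha (b := b)
    (c := fun μ y => ψ ((Lc : ℤ) • y + toSite rr) * linAvgAt (toSite rr) R Lc μ y - linAvgAt (toSite rr) (fun a x => ψ x * R a x) Lc μ y)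
    hTb (by positivity : 0 ≤ E₀ ^ 2 * KB * Cnt) (by positivity : (0 : ℝ) ≤ 2 * αg) u' xg xl hb hc

end Tip

section TipDz

variable {n : ℕ} {κ αg Tb : ℝ} {Ga Gb : ℕ → Site (d + 1) → ℝ} {ψa ψb : Site (d + 1) → ℝ}
  {b : Fin (d + 1) → Site (d + 1) → ℝ} {xg xl u' : Site (d + 1)}

/-- NOT IN PRINT; OUR BOOKKEEPING ([folklore]; every input a letter).  **THE TIP × GRADIENT CELL**: two gauge staircases with localised geometric pieces of the same letter `α_g`
(sources `x_g`, `x_l`), brackets under the tent letter: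
`|Σ_μ Σ'_y b μ y·[tip commutator of ψ_a](dz ψ_b)(μ,y)| ≤ (d+1)·T_b·(E₀²·Cnt)·(4α_g² + 2·(4α_g²)·Lc·n)·((Lc^n)^{d+1}·Zl)·e^{−(κ∕12)(‖x_g − u′‖∞ + ‖x_l − u′‖∞)}` and every `y`-family is summable. -/
theorem abs_sum_tsum_tip_dz_le (hLc : 1 ≤ Lc) (hrr : rr ∈ box (d + 1) Lc) (hκ : 0 < κ) (hαg : 0 ≤ αg) (hTb : 0 ≤ Tb)
    (hψa : ∀ u, ψa u = ∑ s ∈ Finset.range (n + 1), Ga s (blk (Lc ^ s) u))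
    (hψb : ∀ u, ψb u = ∑ s ∈ Finset.range (n + 1), Gb s (blk (Lc ^ s) u))
    (hGa : ∀ s, s ≤ n → ∀ u, |Ga s (blk (Lc ^ s) u)| ≤ αg * (Lc : ℝ) ^ s * Real.exp (-(κ * supNorm (quo (Lc ^ (n + 1)) u - xg))))
    (hGb : ∀ s, s ≤ n → ∀ u, |Gb s (blk (Lc ^ s) u)| ≤ αg * (Lc : ℝ) ^ s * Real.exp (-(κ * supNorm (quo (Lc ^ (n + 1)) u - xl))))
    (hb : ∀ μ y, |b μ y| ≤ Tb * Real.exp (-(κ * supNorm (quo (Lc ^ n) y - u')))) :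
    (∀ μ, Summable fun y : Site (d + 1) => b μ y *
        (linAvgAt (toSite rr) (fun a x => ψa (x + unitVec a) * dz ψb a x) Lc μ y
          - ψa ((Lc : ℤ) • y + toSite rr + (Lc : ℤ) • unitVec μ) * linAvgAt (toSite rr) (dz ψb) Lc μ y)) ∧
    |∑ μ, ∑' y : Site (d + 1), b μ y *
        (linAvgAt (toSite rr) (fun a x => ψa (x + unitVec a) * dz ψb a x) Lc μ y
          - ψa ((Lc : ℤ) • y + toSite rr + (Lc : ℤ) • unitVec μ) * linAvgAt (toSite rr) (dz ψb) Lc μ y)|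
      ≤ ((d : ℝ) + 1) * Tb * (Real.exp (2 * ((d : ℝ) + 1) * κ) ^ 2 *
            (((2 * Lc : ℕ) : ℝ) ^ (d + 1) * (((d + 1 : ℕ) : ℝ) * ((Lc : ℝ) ^ (d + 1) * (ell (d + 1) Lc : ℝ)))))
          * (4 * αg ^ 2 + 2 * (4 * αg ^ 2) * Lc * n) * ((((Lc ^ n : ℕ) : ℝ)) ^ (d + 1) * Zl (d + 1) (κ / (4 * ((d : ℝ) + 1)))) *
          Real.exp (-(κ / 12) * (supNorm (xg - u') + supNorm (xl - u'))) := by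
  set E₀ : ℝ := Real.exp (2 * ((d : ℝ) + 1) * κ) with hE₀
  set Cnt : ℝ := ((2 * Lc : ℕ) : ℝ) ^ (d + 1) * (((d + 1 : ℕ) : ℝ) * ((Lc : ℝ) ^ (d + 1) * (ell (d + 1) Lc : ℝ))) with hCnt
  have hE₀0 : 0 ≤ E₀ := (Real.exp_pos _).le
  have hLn : 1 ≤ Lc ^ n := Nat.one_le_pow _ _ hLc
  have hc : ∀ μ y, |linAvgAt (toSite rr) (fun a x => ψa (x + unitVec a) * dz ψb a x) Lc μ y
        - ψa ((Lc : ℤ) • y + toSite rr + (Lc : ℤ) • unitVec μ) * linAvgAt (toSite rr) (dz ψb) Lc μ y|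
      ≤ (4 * αg ^ 2 + ∑ s ∈ Finset.range n, (if (Lc : ℤ) ^ s ∣ y μ + 1 then 2 * ((fun m => 4 * αg * (αg * (Lc : ℝ) ^ m)) (s + 1)) else 0)) *
        ((E₀ ^ 2 * Cnt) * Real.exp (-(κ * supNorm (quo (Lc ^ n) y - xg))) * Real.exp (-(κ * supNorm (quo (Lc ^ n) y - xl)))) := by
    intro μ y
    classical
    have hWa : ∀ a, ∀ x ∈ nearBox Lc y, |Ga 0 (x + unitVec a) - Ga 0 ((Lc : ℤ) • y + toSite rr + (Lc : ℤ) • unitVec μ)|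
        ≤ 2 * αg * (E₀ * Real.exp (-(κ * supNorm (quo (Lc ^ n) y - xg)))) := by
      intro a x hx
      have h1 := abs_finest_le_env hLc hκ.le hαg hGa (corner_le_of_mem_nearBox_add hLc hx a)
      have h2 := abs_finest_le_env hLc hκ.le hαg hGa (corner_le_root_add hrr y μ)
      calc |Ga 0 (x + unitVec a) - Ga 0 ((Lc : ℤ) • y + toSite rr + (Lc : ℤ) • unitVec μ)|
          ≤ |Ga 0 (x + unitVec a)| + |Ga 0 ((Lc : ℤ) • y + toSite rr + (Lc : ℤ) • unitVec μ)| := abs_sub _ _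
        _ ≤ _ := by linarith
    have hgb := fun a x (hx : x ∈ nearBox Lc y) => abs_dz_finest_le_env hLc hκ.le hαg hGb y a hx
    have hJa := sum_abs_jump_le_env hLc hκ.le hαg hGa μ y
    have hJb := sum_abs_jump_le_env hLc hκ.le hαg hGb μ y
    have h := abs_tipCommutator_dz_le_of_staircase_of_env hLc hrr Ga Gb n hψa hψb μ y (Wa := 2 * αg) (gb := 2 * αg)
      (F := ∑ s ∈ Finset.range n, (if (Lc : ℤ) ^ s ∣ y μ + 1 then 2 * (αg * (Lc : ℝ) ^ (s + 1)) else 0))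
      (Ea := E₀ * Real.exp (-(κ * supNorm (quo (Lc ^ n) y - xg)))) (Eb := E₀ * Real.exp (-(κ * supNorm (quo (Lc ^ n) y - xl))))
      (by positivity) (by positivity) (by positivity) (by positivity) hWa hgb hJa hJb (sum_abs_linCountAt_le_cnt hLc hrr μ y)
    refine h.trans (le_of_eq ?_)
    rw [show (2 * αg + 2 * αg) * ∑ s ∈ Finset.range n, (if (Lc : ℤ) ^ s ∣ y μ + 1 then 2 * (αg * (Lc : ℝ) ^ (s + 1)) else 0)
      = ∑ s ∈ Finset.range n, (if (Lc : ℤ) ^ s ∣ y μ + 1 then 2 * ((fun m => 4 * αg * (αg * (Lc : ℝ) ^ m)) (s + 1)) else 0) by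
        rw [show (2 * αg + 2 * αg) = 4 * αg by ring, mul_sum_ite]]
    ring
  have ha : ∀ s, s < n → 0 ≤ (fun m => 4 * αg * (αg * (Lc : ℝ) ^ m)) (s + 1) ∧
      (fun m => 4 * αg * (αg * (Lc : ℝ) ^ m)) (s + 1) ≤ (4 * αg ^ 2) * (Lc : ℝ) ^ (s + 1) :=
    fun s _ => ⟨by positivity, le_of_eq (by simp only []; ring)⟩
  exact abs_sum_tsum_mul_le_of_env3 (d := d) (Lc := Lc) (M := Lc ^ n) (n := n) hLc hLn (fun s hs => pow_dvd_pow Lc hs.le) hκ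
    (a := fun m => 4 * αg * (αg * (Lc : ℝ) ^ m)) ha (b := b)
    (c := fun μ y => linAvgAt (toSite rr) (fun a x => ψa (x + unitVec a) * dz ψb a x) Lc μ y
          - ψa ((Lc : ℤ) • y + toSite rr + (Lc : ℤ) • unitVec μ) * linAvgAt (toSite rr) (dz ψb) Lc μ y)
    hTb (by positivity : 0 ≤ E₀ ^ 2 * Cnt) (by positivity : (0 : ℝ) ≤ 4 * αg ^ 2) u' xg xl hb hc

end TipDz

/-! ## §2 The entry bound of the fm-channel V contact difference -/

section Entry

variable [NeZero Lc] {n : ℕ} {κ αg KB CT Tb : ℝ}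
  {T B M : Fin (d + 1) → (Fin (d + 1) → ℤ) → Fin (d + 1) → (Fin (d + 1) → ℤ) → ℝ}
  {lam : Fin (d + 1) → (Fin (d + 1) → ℤ) → (Fin (d + 1) → ℤ) → ℝ}
  {G : Fin (d + 1) → (Fin (d + 1) → ℤ) → ℕ → Site (d + 1) → ℝ}

/-- [folklore] **SUBLATTICE RE-INDEXING OF A V CELL**: the multiplier index of the border table runs over the coarse points `z = Lc•y`; on them `off Lc z = 0` and `blk Lc z = y`,
off them the cell vanishes: `Σ'_z Σ_μ M_μ z·[off Lc z = 0]·g μ (blk Lc z) z = Σ'_y Σ_μ M_μ (Lc•y)·g μ y (Lc•y)` (`ResolventComposition.tsum_sublattice₀`, no summability needed). -/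
theorem tsum_sum_mul_ite_off_eq (hLc : 1 ≤ Lc) (Mrow : Fin (d + 1) → Site (d + 1) → ℝ) (g : Fin (d + 1) → Site (d + 1) → Site (d + 1) → ℝ) :
    ∑' z : Site (d + 1), ∑ μ, Mrow μ z * (if off Lc z = 0 then g μ (blk Lc z) z else 0)
      = ∑' y : Site (d + 1), ∑ μ, Mrow μ ((Lc : ℤ) • y) * g μ y ((Lc : ℤ) • y) := by
  refine tsum_sublattice₀ Lc _ _ (fun w hw => ?_) (fun w' => ?_)
  · have hoff : off Lc w ≠ 0 := by
      intro h0
      apply hw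
      rw [eq_smul_blk_of_off_eq_zero hLc h0]
      exact proj_zsmul _
    exact Finset.sum_eq_zero fun μ _ => by rw [if_neg hoff, mul_zero]
  · exact Finset.sum_congr rfl fun μ _ => by rw [if_pos (off_zsmul Lc w'), blk_zsmul hLc]

/-- NOT IN PRINT; OUR BOOKKEEPING ([folklore]; BORNV-PLAN-v0 §4 ∕ BORNSEC-PLAN v1.1 §0 (c) + §0′ per lineage, every analytic input a LETTER).  **THE ENTRY BOUND OF THE fm-CHANNEL V CONTACT
DIFFERENCE.**  Legs `T` (dressed: bounded with summable fine slices) and `B` (undressed: block envelope `K_B·e^{−κ‖quo (Lc^{n+1}) u − z‖∞}`) with `T − B = dz λ`, the bond gauge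
functions `λ_{μ₀z₀}` staircases of depth `n+1` with localised geometric pieces (`α_g·Lc^s`, source label `z₀`), a COMMON multiplier leg `M` with summable fine slices under the TENT letter
`|M β z′ μ (Lc•y)| ≤ T_b·e^{−κ‖quo (Lc^n) y − z′‖∞}`.  THEN for all `κ′ u′ x′ z′ α β`, with `V_ρ = vhSAt ρ d Lc` the bare rooted border table,
`|push₃ T M T (reslot inl inr V_ρ) κ′u′ x′z′ (inl α)(inl β) − push₃ B M B (reslot inl inr V_ρ) κ′u′ x′z′ (inl α)(inl β)|`
`≤ (Lc^{d+1})⁻¹·((d+1)·T_b·(E₀²·Cnt))·(2·K_B·(2α_g + 2α_g·Lc·n) + (4α_g² + 8α_g²·Lc·n))·((Lc^n)^{d+1}·Zl(κ∕(4(d+1))))·e^{−(κ∕12)(‖x′−z′‖∞ + ‖u′−z′‖∞)}`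
— leaf-02 g48's socket `contact_border_fm_eq_factorised` (lᴱ = wᴱ = T, lᴮ = wᴮ = B, common `M`), the sublattice re-indexing, the split `T = B + dz λ` of the TIP cell's dressed leg
(`tipCommutator_eq_sum` is linear in the leg), then §1's TIP, TIP × GRADIENT and ROOT cells. -/
theorem abs_contact_border_fm_le (hLc : 1 ≤ Lc) (hrr : rr ∈ box (d + 1) Lc) (hκ : 0 < κ) (hαg : 0 ≤ αg) (hKB : 0 ≤ KB) (hTb : 0 ≤ Tb)
    (hT : ∀ μ z κ u, |T μ z κ u| ≤ CT) (hTs : ∀ μ z κ, Summable fun u => T μ z κ u)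
    (hB : ∀ μ z l u, |B μ z l u| ≤ KB * Real.exp (-(κ * supNorm (quo (Lc ^ (n + 1)) u - z))))
    (hTB : T - B = fun μ z κ u => dz (lam μ z) κ u)
    (hψ : ∀ μ₀ z₀ u, lam μ₀ z₀ u = ∑ s ∈ Finset.range (n + 1), G μ₀ z₀ s (blk (Lc ^ s) u))
    (hG : ∀ μ₀ z₀ s, s ≤ n → ∀ u, |G μ₀ z₀ s (blk (Lc ^ s) u)| ≤ αg * (Lc : ℝ) ^ s * Real.exp (-(κ * supNorm (quo (Lc ^ (n + 1)) u - z₀))))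
    (hMs : ∀ β z' μ, Summable fun z => M β z' μ z)
    (hMt : ∀ (β : Fin (d + 1)) (z' : Site (d + 1)) (μ : Fin (d + 1)) (y : Site (d + 1)),
      |M β z' μ ((Lc : ℤ) • y)| ≤ Tb * Real.exp (-(κ * supNorm (quo (Lc ^ n) y - z'))))
    (κ' : Fin (d + 1)) (u' x' z' : Site (d + 1)) (α β : Fin (d + 1)) :
    |push₃ T M T (reslot Sum.inl Sum.inr (vhSAt (toSite rr) d Lc rfl)) κ' u' x' z' (Sum.inl α) (Sum.inl β)
        - push₃ B M B (reslot Sum.inl Sum.inr (vhSAt (toSite rr) d Lc rfl)) κ' u' x' z' (Sum.inl α) (Sum.inl β)|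
      ≤ ((Lc : ℝ) ^ (d + 1))⁻¹ *
          ((((d : ℝ) + 1) * Tb * (Real.exp (2 * ((d : ℝ) + 1) * κ) ^ 2 *
              (((2 * Lc : ℕ) : ℝ) ^ (d + 1) * (((d + 1 : ℕ) : ℝ) * ((Lc : ℝ) ^ (d + 1) * (ell (d + 1) Lc : ℝ))))))
            * (2 * KB * (2 * αg + 2 * αg * Lc * n) + (4 * αg ^ 2 + 2 * (4 * αg ^ 2) * Lc * n))
            * ((((Lc ^ n : ℕ) : ℝ)) ^ (d + 1) * Zl (d + 1) (κ / (4 * ((d : ℝ) + 1))))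
            * Real.exp (-(κ / 12) * (supNorm (x' - z') + supNorm (u' - z')))) := by
  -- the leg class of `B` and the socket
  have hLn1 : 1 ≤ Lc ^ (n + 1) := Nat.one_le_pow _ _ hLc
  have hBb : ∀ μ z l u, |B μ z l u| ≤ KB := abs_le_of_env' hκ.le hB
  have hBs : ∀ μ z l, Summable fun u => B μ z l u := summable_of_env' hLn1 hκ hB
  rw [contact_border_fm_eq_factorised hLc hrr hT hTs hBb hBs hMs hT hBb hTB hTB κ' u' x' z' α β]
  -- sublattice re-indexing of the two cells
  rw [tsum_sum_mul_ite_off_eq hLc (fun μ z => M β z' μ z) (fun μ y z => ((Lc : ℝ) ^ (d + 1))⁻¹ *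
      (linAvgAt (toSite rr) (fun κ u => lam α x' (u + unitVec κ) * T κ' u' κ u) Lc μ y
        - lam α x' (z + toSite rr + (Lc : ℤ) • unitVec μ) * linAvgAt (toSite rr) (T κ' u') Lc μ y)),
    tsum_sum_mul_ite_off_eq hLc (fun μ z => M β z' μ z) (fun μ y z => ((Lc : ℝ) ^ (d + 1))⁻¹ *
      (lam κ' u' (z + toSite rr) * linAvgAt (toSite rr) (B α x') Lc μ y
        - linAvgAt (toSite rr) (fun a x => lam κ' u' x * B α x' a x) Lc μ y))]
  -- the split of the TIP cell's dressed leg `T κ′ u′ = B κ′ u′ + dz (λ κ′ u′)`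
  have eT : ∀ b z, T κ' u' b z = B κ' u' b z + dz (lam κ' u') b z := fun b z => by
    have h := congrFun (congrFun (congrFun (congrFun hTB κ') u') b) z
    simp only [Pi.sub_apply] at h
    linarith
  have hsplit : ∀ μ y,
      linAvgAt (toSite rr) (fun b z => lam α x' (z + unitVec b) * T κ' u' b z) Lc μ y
          - lam α x' ((Lc : ℤ) • y + toSite rr + (Lc : ℤ) • unitVec μ) * linAvgAt (toSite rr) (T κ' u') Lc μ y
        = (linAvgAt (toSite rr) (fun b z => lam α x' (z + unitVec b) * B κ' u' b z) Lc μ y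
            - lam α x' ((Lc : ℤ) • y + toSite rr + (Lc : ℤ) • unitVec μ) * linAvgAt (toSite rr) (B κ' u') Lc μ y)
          + (linAvgAt (toSite rr) (fun b z => lam α x' (z + unitVec b) * dz (lam κ' u') b z) Lc μ y
            - lam α x' ((Lc : ℤ) • y + toSite rr + (Lc : ℤ) • unitVec μ) * linAvgAt (toSite rr) (dz (lam κ' u')) Lc μ y) := by
    intro μ y
    rw [tipCommutator_eq_sum hrr, tipCommutator_eq_sum hrr, tipCommutator_eq_sum hrr (lam α x') (dz (lam κ' u')), ← Finset.sum_add_distrib]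
    refine Finset.sum_congr rfl fun x _ => ?_
    rw [← Finset.sum_add_distrib]
    refine Finset.sum_congr rfl fun a _ => ?_
    rw [eT a x]; ring
  -- the three cells (brackets `b μ y := M β z′ μ (Lc•y)`, tent label `z′`)
  obtain ⟨hs1, hb1⟩ := abs_sum_tsum_tip_le (b := fun μ y => M β z' μ ((Lc : ℤ) • y)) (xg := x') (xl := u') (u' := z')
    hLc hrr hκ hαg hKB hTb (hψ α x') (hG α x') (fun a x => hB κ' u' a x) (hMt β z')
  obtain ⟨hs2, hb2⟩ := abs_sum_tsum_tip_dz_le (b := fun μ y => M β z' μ ((Lc : ℤ) • y)) (xg := x') (xl := u') (u' := z')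
    hLc hrr hκ hαg hTb (hψ α x') (hψ κ' u') (hG α x') (hG κ' u') (hMt β z')
  obtain ⟨hs3, hb3⟩ := abs_sum_tsum_root_le (b := fun μ y => M β z' μ ((Lc : ℤ) • y)) (xg := u') (xl := x') (u' := z')
    hLc hrr hκ hαg hKB hTb (hψ κ' u') (hG κ' u') (fun a x => hB α x' a x) (hMt β z')
  rw [add_comm (supNorm (u' - z')) (supNorm (x' - z'))] at hb3
  -- regroup the first cell: constant out, split, exchange
  set c₀ : ℝ := ((Lc : ℝ) ^ (d + 1))⁻¹ with hc₀
  have e1 : (∑' y : Site (d + 1), ∑ μ, M β z' μ ((Lc : ℤ) • y) * (c₀ *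
        (linAvgAt (toSite rr) (fun κ u => lam α x' (u + unitVec κ) * T κ' u' κ u) Lc μ y
          - lam α x' ((Lc : ℤ) • y + toSite rr + (Lc : ℤ) • unitVec μ) * linAvgAt (toSite rr) (T κ' u') Lc μ y)))
      = c₀ * ((∑ μ, ∑' y : Site (d + 1), M β z' μ ((Lc : ℤ) • y) *
          (linAvgAt (toSite rr) (fun b z => lam α x' (z + unitVec b) * B κ' u' b z) Lc μ y
            - lam α x' ((Lc : ℤ) • y + toSite rr + (Lc : ℤ) • unitVec μ) * linAvgAt (toSite rr) (B κ' u') Lc μ y))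
        + ∑ μ, ∑' y : Site (d + 1), M β z' μ ((Lc : ℤ) • y) *
          (linAvgAt (toSite rr) (fun b z => lam α x' (z + unitVec b) * dz (lam κ' u') b z) Lc μ y
            - lam α x' ((Lc : ℤ) • y + toSite rr + (Lc : ℤ) • unitVec μ) * linAvgAt (toSite rr) (dz (lam κ' u')) Lc μ y)) := by
    have step1 : ∀ y : Site (d + 1), (∑ μ, M β z' μ ((Lc : ℤ) • y) * (c₀ *
        (linAvgAt (toSite rr) (fun κ u => lam α x' (u + unitVec κ) * T κ' u' κ u) Lc μ y
          - lam α x' ((Lc : ℤ) • y + toSite rr + (Lc : ℤ) • unitVec μ) * linAvgAt (toSite rr) (T κ' u') Lc μ y)))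
        = c₀ * ∑ μ, (M β z' μ ((Lc : ℤ) • y) *
            (linAvgAt (toSite rr) (fun b z => lam α x' (z + unitVec b) * B κ' u' b z) Lc μ y
              - lam α x' ((Lc : ℤ) • y + toSite rr + (Lc : ℤ) • unitVec μ) * linAvgAt (toSite rr) (B κ' u') Lc μ y)
          + M β z' μ ((Lc : ℤ) • y) *
            (linAvgAt (toSite rr) (fun b z => lam α x' (z + unitVec b) * dz (lam κ' u') b z) Lc μ y
              - lam α x' ((Lc : ℤ) • y + toSite rr + (Lc : ℤ) • unitVec μ) * linAvgAt (toSite rr) (dz (lam κ' u')) Lc μ y)) := by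
      intro y
      rw [Finset.mul_sum]
      refine Finset.sum_congr rfl fun μ _ => ?_
      rw [hsplit μ y]; ring
    rw [tsum_congr step1, tsum_mul_left, Summable.tsum_finsetSum (fun μ _ => (hs1 μ).add (hs2 μ))]
    congr 1
    rw [← Finset.sum_add_distrib]
    exact Finset.sum_congr rfl fun μ _ => (hs1 μ).tsum_add (hs2 μ)
  have e2 : (∑' y : Site (d + 1), ∑ μ, M β z' μ ((Lc : ℤ) • y) * (c₀ *
        (lam κ' u' ((Lc : ℤ) • y + toSite rr) * linAvgAt (toSite rr) (B α x') Lc μ y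
          - linAvgAt (toSite rr) (fun a x => lam κ' u' x * B α x' a x) Lc μ y)))
      = c₀ * ∑ μ, ∑' y : Site (d + 1), M β z' μ ((Lc : ℤ) • y) *
          (lam κ' u' ((Lc : ℤ) • y + toSite rr) * linAvgAt (toSite rr) (B α x') Lc μ y
            - linAvgAt (toSite rr) (fun a x => lam κ' u' x * B α x' a x) Lc μ y) := by
    rw [← Summable.tsum_finsetSum (fun μ _ => hs3 μ), ← tsum_mul_left]
    refine tsum_congr fun y => ?_
    rw [Finset.mul_sum]
    exact Finset.sum_congr rfl fun μ _ => by ring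
  rw [e1, e2, ← mul_add]
  have hc0 : 0 ≤ c₀ := by positivity
  rw [abs_mul, abs_of_nonneg hc0]
  refine (mul_le_mul_of_nonneg_left ((abs_add_le _ _).trans (add_le_add ((abs_add_le _ _).trans (add_le_add hb1 hb2)) hb3)) hc0).trans
    (le_of_eq ?_)
  ring

end Entry

end Summit.QuantumFields.BalabanUV.Beta.GAN24.ContactBorderEntryBound

end
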